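import Literature.Computability.Complexity.HiraharaInstance
import HarnessLib

/-!
# Hirahara's reduction: the asymptotic inequalities

Topic `Computability/Complexity`. Discharge of the three numeric hypotheses of
`HiraharaInstance.lean` — the mass-production arity condition (`hmass`), the density inequality
(`hdens`) and the final union-bound inequality (`hfinal`) — for instances whose size parameter
`λ = 2^{Λ}` dominates the other data (`HiraharaRed.PInst.Big`: `Λ ≥ 4096`, `n, ν ≤ 2^{Λ/4}`,
`w_k, θ ≤ 2^{Λ}`) and whose weight threshold satisfies `W₀ ≥ 107520 θ` (which is `⌊Δ^α θ⌋ ≥ 107520 θ`,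
i.e. `n ≥ n₀(α)`, in the final assembly). This is the "for all sufficiently large n" bookkeeping of
the proofs of Lemma 8.3 and Thm. 8.5 (ECCC TR22-119, pp. 28–31: `λ^{o(1)}`, `o(λ)`,
`(1 - o(1)) λ w(B)`), carried out with explicit (generous) constants in `ℕ`.

## References

* S. Hirahara, *NP-hardness of learning programs and partial MCSP*, ECCC TR22-119, proofs of
  Lemma 8.3 and Thm. 8.5 (pp. 28–31) [Hirahara2022PartialMCSP].
-/

namespace Literature.Computability.Complexity

open Finset
open Literature.Computability.MetaComplexity (MonotoneDNF MCSPStar sqrtLog)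
open Literature.Computability.MetaComplexity.NWLexLinear (linDesign isNWDesign_linDesign)
open Literature.Computability.MetaComplexity.MonotoneDNF (BenalohLeichter.Rand)

namespace HiraharaRed

/-! ### Growth toolkit: `x ≤ 2^{x/16}` -/

namespace Growth

/-- `x ≤ 2^{x/16}` for `x ≥ 128`. [folklore] -/
theorem le_two_pow_div16 : ∀ x : ℕ, 128 ≤ x → x ≤ 2 ^ (x / 16) := by
  -- strong induction in steps of 16
  intro x
  induction x using Nat.strong_induction_on with
  | _ x ih =>
    intro hx
    by_cases h : x < 144
    · interval_cases x <;> norm_num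
    · have hy : 128 ≤ x - 16 := by omega
      have ih' := ih (x - 16) (by omega) hy
      have h16 : 16 ≤ 2 ^ ((x - 16) / 16) := by
        calc (16 : ℕ) = 2 ^ 4 := by norm_num
          _ ≤ 2 ^ ((x - 16) / 16) := Nat.pow_le_pow_right (by norm_num) (by omega)
      have hdiv : (x - 16) / 16 + 1 = x / 16 := by omega
      calc x = (x - 16) + 16 := by omega
        _ ≤ 2 ^ ((x - 16) / 16) + 2 ^ ((x - 16) / 16) := Nat.add_le_add ih' h16
        _ = 2 ^ ((x - 16) / 16 + 1) := by rw [pow_succ]; ring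
        _ = 2 ^ (x / 16) := by rw [hdiv]

/-- `x^k ≤ 2^{k (x/16)}` for `x ≥ 128`. [folklore] -/
theorem pow_le_two_pow_mul_div16 {x : ℕ} (hx : 128 ≤ x) (k : ℕ) : x ^ k ≤ 2 ^ (k * (x / 16)) := by
  calc x ^ k ≤ (2 ^ (x / 16)) ^ k := Nat.pow_le_pow_left (le_two_pow_div16 x hx) k
    _ = 2 ^ (k * (x / 16)) := by rw [← pow_mul, mul_comm]

/-- **Polynomial versus exponential**: `2^a · x^k ≤ 2^x` once `x ≥ 128` and `16 a + k x ≤ 16 x - 16 k`… in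
the convenient form `a + k · (x/16) ≤ x`. [folklore] -/
theorem two_pow_mul_pow_le {a k x : ℕ} (hx : 128 ≤ x) (h : a + k * (x / 16) ≤ x) : 2 ^ a * x ^ k ≤ 2 ^ x := by
  calc 2 ^ a * x ^ k ≤ 2 ^ a * 2 ^ (k * (x / 16)) := Nat.mul_le_mul_left _ (pow_le_two_pow_mul_div16 hx k)
    _ = 2 ^ (a + k * (x / 16)) := by rw [← pow_add]
    _ ≤ 2 ^ x := Nat.pow_le_pow_right (by norm_num) h

/-- `log₂ x + 1 ≤ x / 16 + 8`… in the form used: `Nat.log 2 x ≤ x / 16 + 7` for all `x`. [folklore] -/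
theorem log_le_div16 (x : ℕ) : Nat.log 2 x ≤ x / 16 + 7 := by
  rcases lt_or_ge x 128 with h | h
  · have : Nat.log 2 x < 7 := by
      rcases Nat.eq_zero_or_pos x with rfl | hx
      · simp
      · exact (Nat.log_lt_iff_lt_pow (by norm_num) hx.ne').2 (by omega)
    omega
  · have h1 : x < 2 ^ (x / 16 + 8) := by
      calc x ≤ 2 ^ (x / 16) := le_two_pow_div16 x h
        _ < 2 ^ (x / 16 + 8) := Nat.pow_lt_pow_right (by norm_num) (by omega)
    have := (Nat.log_lt_iff_lt_pow (by norm_num) (by omega)).2 h1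
    omega

/-- `(4t + 28)(t + 4) ≤ 2^t` for `t ≥ 12`. [folklore] -/
theorem quad_le_two_pow : ∀ t : ℕ, 12 ≤ t → (4 * t + 28) * (t + 4) ≤ 2 ^ t := by
  intro t ht
  induction t with
  | zero => omega
  | succ t ih =>
    rcases Nat.eq_or_lt_of_le ht with h | h
    · rw [← h]; norm_num
    · have := ih (by omega)
      rw [pow_succ]
      nlinarith


end Growth

open Growth

namespace PInst

open scoped Classical

variable (I : PInst)

/-- **The largeness hypotheses**: `λ = 2^{Λ}` dominates the instance. [cite: Hirahara2022PartialMCSP, proof of Lemma 8.3 ("λ := max{mΔ, (nm)², θ, (nΔ w_max)^4}", "for all sufficiently large n")] -/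
structure Big : Prop where
  /-- well-formedness -/
  good : I.Good
  /-- `Λ ≥ 4096` -/
  Λ_ge : 4096 ≤ I.logLam
  /-- `n ≤ 2^{Λ/4}` -/
  n_le : I.n ≤ 2 ^ (I.logLam / 4)
  /-- `ν ≤ 2^{Λ/4}` -/
  ν_le : I.ν ≤ 2 ^ (I.logLam / 4)
  /-- `w_k ≤ 2^{Λ}` -/
  w_le : ∀ k, I.w k ≤ 2 ^ I.logLam
  /-- `θ ≤ 2^{Λ}` -/
  θ_le : I.θ ≤ 2 ^ I.logLam

variable {I}

section Bounds

variable (hB : I.Big)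
include hB

/-- `Δ² ≤ Λ/4`. [folklore] -/
theorem Big.Δsq_le : I.Δ * I.Δ ≤ I.logLam / 4 := by
  have h1 : I.Δ * I.Δ ≤ Nat.log 2 I.n := by
    unfold Δ; rw [MetaComplexity.sqrtLog]; exact Nat.sqrt_le _
  have h2 : Nat.log 2 I.n ≤ I.logLam / 4 := by
    calc Nat.log 2 I.n ≤ Nat.log 2 (2 ^ (I.logLam / 4)) := Nat.log_mono_right hB.n_le
      _ = I.logLam / 4 := Nat.log_pow (by norm_num) _
  exact h1.trans h2

/-- `1 ≤ Δ`. [folklore] -/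
theorem Big.one_le_Δ : 1 ≤ I.Δ := I.one_le_Δ hB.good.two_le_n

/-- `Δ ≤ Λ/4`. [folklore] -/
theorem Big.Δ_le : I.Δ ≤ I.logLam / 4 :=
  le_trans (Nat.le_mul_of_pos_left _ hB.one_le_Δ) hB.Δsq_le

/-- `k_A ≤ 24 Λ`. [folklore] -/
theorem Big.kA_le : I.kA ≤ 24 * I.logLam := by
  unfold kA; have := hB.Δsq_le; omega

/-- `1 ≤ k_A`. [folklore] -/
theorem Big.one_le_kA : 1 ≤ I.kA := I.kA_pos hB.good.two_le_n

/-- `k_A < 2^{Λ}` (so `k_A ≤ 2^{N_k}`). [folklore] -/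
theorem Big.kA_lt_two_pow : I.kA < 2 ^ I.logLam := by
  have h := hB.kA_le
  have hΛ := hB.Λ_ge
  calc I.kA ≤ 24 * I.logLam := h
    _ < 2 ^ I.logLam := by
        have h1 : 24 * I.logLam ≤ 2 ^ 5 * I.logLam ^ 1 := by rw [pow_one]; omega
        have h2 : 2 ^ 5 * I.logLam ^ 1 ≤ 2 ^ I.logLam := two_pow_mul_pow_le (by omega) (by omega)
        have h3 : 2 ^ 5 * I.logLam ^ 1 < 2 ^ 5 * I.logLam ^ 1 + 1 := Nat.lt_succ_self _
        -- strict: `24 Λ < 32 Λ ≤ 2^Λ`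
        have : 24 * I.logLam < 2 ^ 5 * I.logLam ^ 1 := by rw [pow_one]; omega
        exact lt_of_lt_of_le this h2

/-- `mI ≤ Λ`. [folklore] -/
theorem Big.mI_le : I.mI ≤ I.logLam := by
  unfold mI
  have h := (Nat.log_lt_iff_lt_pow (by norm_num) (by have := hB.one_le_kA; omega) |>.2 hB.kA_lt_two_pow)
  omega

/-- `N_k ≤ 2Λ + 1`. [folklore] -/
theorem Big.N_le (k : Fin I.n) : I.N k ≤ 2 * I.logLam + 1 := by
  unfold N lam
  have hw : max 1 (I.w k) ≤ 2 ^ I.logLam := max_le (Nat.one_le_two_pow) (hB.w_le k)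
  have : max 1 (I.w k) * 2 ^ I.logLam ≤ 2 ^ (2 * I.logLam) := by
    calc max 1 (I.w k) * 2 ^ I.logLam ≤ 2 ^ I.logLam * 2 ^ I.logLam := Nat.mul_le_mul_right _ hw
      _ = 2 ^ (2 * I.logLam) := by rw [← pow_add, two_mul]
  calc Nat.log 2 (max 1 (I.w k) * 2 ^ I.logLam) + 1 ≤ Nat.log 2 (2 ^ (2 * I.logLam)) + 1 :=
        Nat.succ_le_succ (Nat.log_mono_right this)
    _ = 2 * I.logLam + 1 := by rw [Nat.log_pow (by norm_num)]

/-- `Nbig ≤ 2Λ + 1`. [folklore] -/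
theorem Big.Nbig_le : I.Nbig ≤ 2 * I.logLam + 1 := by
  unfold Nbig lam
  have hw : max 1 ((univ : Finset (Fin I.n)).sup I.w) ≤ 2 ^ I.logLam :=
    max_le (Nat.one_le_two_pow) (Finset.sup_le fun k _ => hB.w_le k)
  have : max 1 ((univ : Finset (Fin I.n)).sup I.w) * 2 ^ I.logLam ≤ 2 ^ (2 * I.logLam) := by
    calc max 1 ((univ : Finset (Fin I.n)).sup I.w) * 2 ^ I.logLam ≤ 2 ^ I.logLam * 2 ^ I.logLam :=
          Nat.mul_le_mul_right _ hw
      _ = 2 ^ (2 * I.logLam) := by rw [← pow_add, two_mul]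
  calc Nat.log 2 (max 1 ((univ : Finset (Fin I.n)).sup I.w) * 2 ^ I.logLam) + 1 ≤ Nat.log 2 (2 ^ (2 * I.logLam)) + 1 :=
        Nat.succ_le_succ (Nat.log_mono_right this)
    _ = 2 * I.logLam + 1 := by rw [Nat.log_pow (by norm_num)]

/-- `seedLen k = 18 N_k + mI ≤ 38 Λ`. [folklore] -/
theorem Big.seedLen_le (k : Fin I.n) : I.raw.seedLen k ≤ 38 * I.logLam := by
  have h1 := hB.N_le k
  have h2 := hB.mI_le
  change I.N k * 4 ^ 2 + ((I.N k + I.mI) + I.N k) ≤ 38 * I.logLam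
  have hΛ := hB.Λ_ge
  nlinarith

/-- `ℓ ≤ 38 Λ`. [folklore] -/
theorem Big.ℓ_le : I.ℓ ≤ 38 * I.logLam := by
  unfold ℓ; exact Finset.sup_le fun k _ => hB.seedLen_le k

/-- `18 (Λ + 1) ≤ ℓ` (there is a variable). [folklore] -/
theorem Big.le_ℓ : 18 * (I.logLam + 1) ≤ I.ℓ := by
  have hn : 0 < I.n := lt_of_lt_of_le (by norm_num) hB.good.two_le_n
  set k : Fin I.n := ⟨0, hn⟩
  have h1 : I.raw.seedLen k ≤ I.ℓ := I.seedLen_le_ℓ k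
  have h2 : 18 * (I.logLam + 1) ≤ I.raw.seedLen k := by
    change 18 * (I.logLam + 1) ≤ I.N k * 4 ^ 2 + ((I.N k + I.mI) + I.N k)
    have := I.logLam_lt_N k
    nlinarith
  exact h2.trans h1

/-- `1 ≤ ℓ`. [folklore] -/
theorem Big.one_le_ℓ : 1 ≤ I.ℓ := le_trans (by omega) hB.le_ℓ

/-- `Λ ≤ 2^{Λ/16}` instance of the toolkit. [folklore] -/
theorem Big.Λ_le_two_pow_div16 : I.logLam ≤ 2 ^ (I.logLam / 16) := le_two_pow_div16 _ (le_trans (by norm_num) hB.Λ_ge)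

/-- `n Δ ≤ 2^{Λ/2}`. [folklore] -/
theorem Big.nΔ_le : I.n * I.Δ ≤ 2 ^ (I.logLam / 2) := by
  have h1 := hB.n_le
  have h2 : I.Δ ≤ 2 ^ (I.logLam / 16) := hB.Δ_le.trans ((Nat.div_le_self _ _).trans hB.Λ_le_two_pow_div16)
  calc I.n * I.Δ ≤ 2 ^ (I.logLam / 4) * 2 ^ (I.logLam / 16) := Nat.mul_le_mul h1 h2
    _ = 2 ^ (I.logLam / 4 + I.logLam / 16) := by rw [← pow_add]
    _ ≤ 2 ^ (I.logLam / 2) := Nat.pow_le_pow_right (by norm_num) (by omega)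

/-- `n Δ ≤ 2^{ℓ}`. [folklore] -/
theorem Big.nΔ_le_two_pow_ℓ : I.n * I.Δ ≤ 2 ^ I.ℓ :=
  hB.nΔ_le.trans (Nat.pow_le_pow_right (by norm_num) (by have := hB.le_ℓ; omega))

/-- The amplification design is the greedy-code design (sizes allow). [cite: Hirahara2022PartialMCSP, proof of Lemma 8.1] -/
theorem Big.eA_eq (k : Fin I.n) :
    I.eA k = linDesign 2 (I.N k) I.kA le_rfl (by have := I.logLam_lt_N k; omega)
      (hB.kA_lt_two_pow.le.trans (Nat.pow_le_pow_right (by norm_num) (I.logLam_lt_N k).le)) := by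
  unfold eA
  rw [dif_pos ⟨by have := I.logLam_lt_N k; omega,
    hB.kA_lt_two_pow.le.trans (Nat.pow_le_pow_right (by norm_num) (I.logLam_lt_N k).le)⟩]

/-- The Nisan–Wigderson design is the greedy-code design (sizes allow). [cite: Hirahara2022PartialMCSP, proof of Lemma 8.3] -/
theorem Big.E_eq : I.E = fun p => linDesign 140 I.ℓ (I.n * I.Δ) (by norm_num) hB.one_le_ℓ hB.nΔ_le_two_pow_ℓ
    (finProdFinEquiv p) := by
  unfold E
  rw [dif_pos ⟨hB.one_le_ℓ, hB.nΔ_le_two_pow_ℓ⟩]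

/-- Design property of the amplification design: intersections `≤ N_k / 2`. [cite: Hirahara2022PartialMCSP, Prop. 6.2] -/
theorem Big.eA_inter_le (k : Fin I.n) ⦃i j : Fin I.kA⦄ (hij : i ≠ j) :
    (univ.map (I.eA k i) ∩ univ.map (I.eA k j)).card ≤ I.N k / 2 := by
  rw [hB.eA_eq k]
  exact isNWDesign_linDesign _ _ _ hij

/-- Design property of the Nisan–Wigderson design: intersections `≤ ℓ / 140`. [cite: Hirahara2022PartialMCSP, Prop. 6.2] -/
theorem Big.E_inter_le ⦃p q : Fin I.n × Fin I.Δ⦄ (hpq : p ≠ q) :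
    (univ.map (I.E p) ∩ univ.map (I.E q)).card ≤ I.ℓ / 140 := by
  rw [hB.E_eq]
  exact isNWDesign_linDesign _ _ _ (fun h => hpq (finProdFinEquiv.injective h))

/-! ### The mass-production condition -/

/-- **The mass-production arity condition** `(2τ + 8)(log₂ N_k + 2) ≤ N_k`. [cite: Hirahara2022PartialMCSP, Lemma 8.2 (n − ⌈log r⌉ − O(1) with r = poly(log))] -/
theorem Big.hmass (k : Fin I.n) : (2 * I.τ + 8) * (Nat.log 2 (I.N k) + 2) ≤ I.N k := by
  set t := Nat.log 2 I.logLam with ht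
  have hΛ := hB.Λ_ge
  have ht12 : 12 ≤ t := by
    rw [ht]; exact Nat.le_log_of_pow_le (by norm_num) (le_trans (by norm_num) hΛ)
  have hΛlt : I.logLam < 2 ^ (t + 1) := Nat.lt_pow_succ_log_self (by norm_num) _
  have htΛ : 2 ^ t ≤ I.logLam := Nat.pow_log_le_self 2 (by omega)
  -- `τ ≤ 2t + 10`: `Δ k_A ≤ 24 Λ² < 2^{2t+2+5}`
  have hτ : I.τ ≤ 2 * t + 10 := by
    unfold τ
    have h1 : I.Δ * I.kA < 2 ^ (2 * t + 7) := by
      calc I.Δ * I.kA ≤ I.logLam * (24 * I.logLam) := Nat.mul_le_mul (hB.Δ_le.trans (Nat.div_le_self _ _)) hB.kA_le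
        _ < 2 ^ (t + 1) * (32 * 2 ^ (t + 1)) := by
            have : 24 * I.logLam < 32 * 2 ^ (t + 1) := by omega
            exact Nat.mul_lt_mul'' hΛlt this
        _ = 2 ^ (2 * t + 7) := by
            rw [show (32 : ℕ) = 2 ^ 5 by norm_num, ← pow_add, ← pow_add]; ring_nf
    have hpos : I.Δ * I.kA ≠ 0 := (Nat.mul_pos hB.one_le_Δ hB.one_le_kA).ne'
    have := (Nat.log_lt_iff_lt_pow (by norm_num) hpos).2 h1
    omega
  -- `log₂ N_k ≤ t + 2`
  have hN : Nat.log 2 (I.N k) ≤ t + 2 := by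
    have h1 : I.N k < 2 ^ (t + 3) := by
      calc I.N k ≤ 2 * I.logLam + 1 := hB.N_le k
        _ < 2 ^ (t + 3) := by rw [pow_succ, pow_succ]; omega
    have hpos : I.N k ≠ 0 := by have := I.logLam_lt_N k; omega
    have := (Nat.log_lt_iff_lt_pow (by norm_num) hpos).2 h1
    omega
  calc (2 * I.τ + 8) * (Nat.log 2 (I.N k) + 2) ≤ (4 * t + 28) * (t + 4) := Nat.mul_le_mul (by omega) (by omega)
    _ ≤ 2 ^ t := quad_le_two_pow t ht12
    _ ≤ I.logLam := htΛ
    _ ≤ I.N k := (I.logLam_lt_N k).le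

end Bounds

/-! ### Powers of two bookkeeping -/

/-- Products of quantities bounded by powers of two. [folklore] -/
theorem mul_le_two_pow_add {a b ea eb : ℕ} (ha : a ≤ 2 ^ ea) (hb : b ≤ 2 ^ eb) : a * b ≤ 2 ^ (ea + eb) := by
  rw [pow_add]; exact Nat.mul_le_mul ha hb

/-- Powers of quantities bounded by powers of two. [folklore] -/
theorem pow_le_two_pow_mul {a ea : ℕ} (ha : a ≤ 2 ^ ea) (c : ℕ) : a ^ c ≤ 2 ^ (ea * c) := by
  rw [pow_mul]; exact Nat.pow_le_pow_left ha c

/-- A formula without the empty term has at most `numLiterals` terms. [folklore] -/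
theorem length_le_numLiterals (φ₀ : MonotoneDNF) (h : [] ∉ φ₀) : φ₀.length ≤ φ₀.numLiterals := by
  unfold MonotoneDNF.numLiterals
  induction φ₀ with
  | nil => simp
  | cons t ts ih =>
    simp only [List.mem_cons, not_or] at h
    simp only [List.length_cons, List.map_cons, List.sum_cons]
    have h1 : 1 ≤ t.length := by
      rcases t with _ | ⟨a, t'⟩
      · exact absurd rfl h.1
      · simp
    have := ih h.2
    omega

/-! ### Cardinality bounds for the density inequality -/

section Cards

variable (hB : I.Big)
include hB

/-- `|Suf k| ≤ 2^{38Λ}`. [folklore] -/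
theorem Big.card_Suf_le (k : Fin I.n) : Fintype.card (I.A.Suf k) ≤ 2 ^ (38 * I.logLam) := by
  rw [show I.A = mkAmpData I.raw I.ℓ I.seedLen_le_ℓ from rfl, card_Suf_mkAmpData]
  exact Nat.pow_le_pow_right (by norm_num) ((Nat.sub_le _ _).trans hB.ℓ_le)

/-- `C ≤ 2^8 Λ²`. [folklore] -/
theorem Big.Ccap_le : I.Ccap ≤ 2 ^ 8 * I.logLam ^ 2 := by
  unfold Ccap
  have h := hB.Δsq_le
  have h4 : I.logLam / 4 * 4 ≤ I.logLam := Nat.div_mul_le_self _ _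
  calc 3072 * (I.Δ * I.Δ) ^ 2 ≤ 3072 * (I.logLam / 4) ^ 2 := by gcongr
    _ ≤ 2 ^ 8 * I.logLam ^ 2 := by nlinarith

/-- `C² ≤ 2^{17} Λ⁴` and `C² + 1 ≤ 2^{17} Λ⁴`. [folklore] -/
theorem Big.Ccap_sq_succ_le : I.Ccap ^ 2 + 1 ≤ 2 ^ 17 * I.logLam ^ 4 := by
  have hΛ := hB.Λ_ge
  calc I.Ccap ^ 2 + 1 ≤ (2 ^ 8 * I.logLam ^ 2) ^ 2 + 1 := by gcongr; exact hB.Ccap_le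
    _ = 2 ^ 16 * I.logLam ^ 4 + 1 := by ring
    _ ≤ 2 ^ 17 * I.logLam ^ 4 := by
        have : 1 ≤ I.logLam ^ 4 := Nat.one_le_pow _ _ (by omega)
        omega

/-- `C² ≤ 2^{17} Λ⁴`. [folklore] -/
theorem Big.Ccap_sq_le : I.Ccap ^ 2 ≤ 2 ^ 17 * I.logLam ^ 4 := le_trans (Nat.le_succ _) hB.Ccap_sq_succ_le

/-- `C² + 1 ≤ 2^{Λ}`. [folklore] -/
theorem Big.Ccap_sq_succ_le_two_pow : I.Ccap ^ 2 + 1 ≤ 2 ^ I.logLam :=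
  hB.Ccap_sq_succ_le.trans (two_pow_mul_pow_le (le_trans (by norm_num) hB.Λ_ge) (by have := hB.Λ_ge; omega))

omit hB in
/-- `|Hankel.Seed N m| = 2^{(N+m)+N}`. [folklore] -/
theorem card_hankelSeed (N m : ℕ) : Fintype.card (Hankel.Seed N m) = 2 ^ ((N + m) + N) := by
  rw [Fintype.card_prod, Fintype.card_fun, Fintype.card_fun, ZMod.card, Fintype.card_fin,
    Fintype.card_fin, ← pow_add]

omit hB in
/-- The raw fields of the concrete amplification data. [folklore] -/
theorem A_eA (k : Fin I.n) : I.A.eA k = I.eA k := rfl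

omit hB in
/-- The raw fields of the concrete amplification data. [folklore] -/
theorem A_mI (k : Fin I.n) : I.A.mI k = I.mI := rfl

omit hB in
/-- The raw fields of the concrete amplification data. [folklore] -/
theorem A_N (k : Fin I.n) : I.A.N k = I.N k := rfl

omit hB in
/-- The raw fields of the concrete amplification data. [folklore] -/
theorem A_dA (k : Fin I.n) : I.A.dA k = I.N k * 4 ^ 2 := rfl

/-- `|Adv_IW(k)| ≤ 2^{2Λ + 18 N_k + 1 + 24Λ·2^{N_k/2}}`. [cite: Hirahara2022PartialMCSP, Lemma 8.1 (advice 2^{γn}·poly(1/ϵδ))] -/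
theorem Big.card_AdvIW_le (k : Fin I.n) :
    Fintype.card (IWAmp.Adv (I.eA k) (m := I.mI)) ≤
      2 ^ (2 * I.logLam + 18 * I.N k + 1 + 24 * I.logLam * 2 ^ (I.N k / 2)) := by
  have h := IWAmp.card_Adv_le (e := I.eA k) (m := I.mI) (Big.eA_inter_le hB k)
  refine h.trans ?_
  rw [card_hankelSeed]
  have hkA : I.kA ≤ 2 ^ I.logLam := hB.kA_lt_two_pow.le
  have h1 : 2 ^ (I.N k * 4 ^ 2) * 2 ^ ((I.N k + I.mI) + I.N k) * 2 * 2 ^ (I.kA * 2 ^ (I.N k / 2)) ≤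
      2 ^ ((I.N k * 4 ^ 2 + ((I.N k + I.logLam) + I.N k) + 1) + 24 * I.logLam * 2 ^ (I.N k / 2)) := by
    refine mul_le_two_pow_add (mul_le_two_pow_add (mul_le_two_pow_add le_rfl ?_) (by norm_num)) ?_
    · exact Nat.pow_le_pow_right (by norm_num) (by have := hB.mI_le; omega)
    · exact Nat.pow_le_pow_right (by norm_num) (Nat.mul_le_mul_right _ hB.kA_le)
  refine (mul_le_two_pow_add hkA h1).trans (Nat.pow_le_pow_right (by norm_num) (le_of_eq ?_))
  ring

/-- `|Rand(φⱼ)| ≤ 2^{Λ}`. [folklore] -/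
theorem Big.card_Rand_le (j : Fin I.ν) : Fintype.card (BenalohLeichter.Rand (I.φ j)) ≤ 2 ^ I.logLam := by
  rw [Fintype.card_fun, Fintype.card_bool, Fintype.card_prod, Fintype.card_fin, Fintype.card_fin]
  refine Nat.pow_le_pow_right (by norm_num) ?_
  have h1 : (I.φ j).length ≤ I.Δ := (length_le_numLiterals _ (hB.good.nil_notMem j)).trans (hB.good.numLiterals_le j)
  have h2 : (I.φ j).numLiterals ≤ I.Δ := hB.good.numLiterals_le j
  calc (I.φ j).length * (I.φ j).numLiterals ≤ I.Δ * I.Δ := Nat.mul_le_mul h1 h2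
    _ ≤ I.logLam / 4 := hB.Δsq_le
    _ ≤ I.logLam := Nat.div_le_self _ _

/-- The exponent of the NW advice: `d + nΔ + 1 + nΔ·2^{ℓ/140} ≤ 2^{Λ-6}`. [cite: Hirahara2022PartialMCSP, Lemma 6.6 (advice Σ 2^{|Sᵢ∩Sⱼ|} = nΔ·λ^{o(1)})] -/
theorem Big.eNW_le : I.dNW + I.n * I.Δ + 1 + I.n * I.Δ * 2 ^ (I.ℓ / 140) ≤ 2 ^ (I.logLam - 6) := by
  have hΛ := hB.Λ_ge
  have hℓ := hB.ℓ_le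
  have hnΔ := hB.nΔ_le
  have hΛ16 := hB.Λ_le_two_pow_div16
  -- `d = ℓ 4^140 ≤ 38 Λ 2^280 ≤ 2^{Λ/16 + 286} ≤ 2^{Λ-8}`
  have hd : I.dNW ≤ 2 ^ (I.logLam - 8) := by
    unfold dNW
    calc I.ℓ * 4 ^ 140 ≤ 38 * I.logLam * 2 ^ 280 := by
          rw [show (4 : ℕ) ^ 140 = 2 ^ 280 by rw [show (4 : ℕ) = 2 ^ 2 by norm_num, ← pow_mul]]
          exact Nat.mul_le_mul_right _ hℓ
      _ ≤ 2 ^ 6 * 2 ^ (I.logLam / 16) * 2 ^ 280 :=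
          Nat.mul_le_mul_right _ (Nat.mul_le_mul (by norm_num) hΛ16)
      _ = 2 ^ (6 + I.logLam / 16 + 280) := by rw [← pow_add, ← pow_add]
      _ ≤ 2 ^ (I.logLam - 8) := Nat.pow_le_pow_right (by norm_num) (by omega)
  -- `nΔ 2^{ℓ/140} ≤ 2^{Λ/2} 2^{5Λ/16} ≤ 2^{Λ - 8}`
  have hρ : I.ℓ / 140 ≤ 5 * I.logLam / 16 := by
    calc I.ℓ / 140 ≤ 38 * I.logLam / 140 := Nat.div_le_div_right hℓ
      _ ≤ 5 * I.logLam / 16 := by omega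
  have h3 : I.n * I.Δ * 2 ^ (I.ℓ / 140) ≤ 2 ^ (I.logLam - 8) := by
    calc I.n * I.Δ * 2 ^ (I.ℓ / 140) ≤ 2 ^ (I.logLam / 2) * 2 ^ (5 * I.logLam / 16) :=
          Nat.mul_le_mul hnΔ (Nat.pow_le_pow_right (by norm_num) hρ)
      _ = 2 ^ (I.logLam / 2 + 5 * I.logLam / 16) := by rw [← pow_add]
      _ ≤ 2 ^ (I.logLam - 8) := Nat.pow_le_pow_right (by norm_num) (by omega)
  have h2 : I.n * I.Δ + 1 ≤ 2 ^ (I.logLam - 8) := by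
    calc I.n * I.Δ + 1 ≤ 2 ^ (I.logLam / 2) + 2 ^ (I.logLam / 2) := Nat.add_le_add hnΔ Nat.one_le_two_pow
      _ = 2 ^ (I.logLam / 2 + 1) := by rw [pow_succ]; ring
      _ ≤ 2 ^ (I.logLam - 8) := Nat.pow_le_pow_right (by norm_num) (by omega)
  calc I.dNW + I.n * I.Δ + 1 + I.n * I.Δ * 2 ^ (I.ℓ / 140)
      ≤ 2 ^ (I.logLam - 8) + 2 ^ (I.logLam - 8) + 2 ^ (I.logLam - 8) := by omega
    _ ≤ 4 * 2 ^ (I.logLam - 8) := by omega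
    _ = 2 ^ (I.logLam - 6) := by
        rw [show (4 : ℕ) = 2 ^ 2 by norm_num, ← pow_add]; congr 1; omega

/-- `|Adv_NW(k,t)| ≤ 2^{2^{Λ-6}}`. [cite: Hirahara2022PartialMCSP, Lemma 6.6 (advice)] -/
theorem Big.card_AdvNW_le (p : Fin I.n × Fin I.Δ) : Fintype.card (NWExtract.Adv I.E p) ≤ 2 ^ 2 ^ (I.logLam - 6) := by
  have h := NWExtract.card_Adv_le (E := I.E) (Big.E_inter_le hB) p
  rw [show Fintype.card (Fin I.n × Fin I.Δ) = I.n * I.Δ by simp] at h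
  refine h.trans ?_
  calc 2 ^ I.dNW * 2 ^ (I.n * I.Δ) * 2 * 2 ^ (I.n * I.Δ * 2 ^ (I.ℓ / 140))
      = 2 ^ (I.dNW + I.n * I.Δ + 1 + I.n * I.Δ * 2 ^ (I.ℓ / 140)) := by
        rw [pow_add, pow_add, pow_add, pow_one]
    _ ≤ 2 ^ 2 ^ (I.logLam - 6) := Nat.pow_le_pow_right (by norm_num) hB.eNW_le

/-- `|Par k| ≤ 2^{3Λ + 2^{Λ-6}}`. [cite: Hirahara2022PartialMCSP, proof of Lemma 8.3 (advice (b, j, shares) and Lemma 6.6 advice)] -/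
theorem Big.card_Par_le (k : Fin I.n) : Fintype.card (Par I.E I.φ k) ≤ 2 ^ (3 * I.logLam + 2 ^ (I.logLam - 6)) := by
  have hΛ := hB.Λ_ge
  have hcard : Fintype.card (Par I.E I.φ k) =
      ∑ j : Fin I.ν, (2 * (Fintype.card (BenalohLeichter.Rand (I.φ j)) *
        ∑ t : Fin I.Δ, Fintype.card (NWExtract.Adv I.E (k, t)))) := by
    rw [show Fintype.card (Par I.E I.φ k) = ∑ j : Fin I.ν, Fintype.card (Bool × BenalohLeichter.Rand (I.φ j) ×
        Σ t : Fin I.Δ, NWExtract.Adv I.E (k, t)) from Fintype.card_sigma]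
    refine Finset.sum_congr rfl fun j _ => ?_
    rw [Fintype.card_prod, Fintype.card_prod, Fintype.card_bool, Fintype.card_sigma]
  rw [hcard]
  have hinner : ∀ j : Fin I.ν, 2 * (Fintype.card (BenalohLeichter.Rand (I.φ j)) *
      ∑ t : Fin I.Δ, Fintype.card (NWExtract.Adv I.E (k, t))) ≤ 2 ^ (1 + I.logLam + (I.logLam + 2 ^ (I.logLam - 6))) := by
    intro j
    rw [pow_add, pow_add, pow_one, mul_assoc]
    refine Nat.mul_le_mul_left _ (Nat.mul_le_mul (hB.card_Rand_le j) ?_)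
    calc ∑ t : Fin I.Δ, Fintype.card (NWExtract.Adv I.E (k, t)) ≤ ∑ _t : Fin I.Δ, 2 ^ 2 ^ (I.logLam - 6) :=
          Finset.sum_le_sum fun t _ => hB.card_AdvNW_le (k, t)
      _ = I.Δ * 2 ^ 2 ^ (I.logLam - 6) := by simp
      _ ≤ 2 ^ I.logLam * 2 ^ 2 ^ (I.logLam - 6) := Nat.mul_le_mul_right _
          ((hB.Δ_le.trans (Nat.div_le_self _ _)).trans (Nat.lt_two_pow_self).le)
      _ = 2 ^ (I.logLam + 2 ^ (I.logLam - 6)) := by rw [← pow_add]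
  calc ∑ j : Fin I.ν, (2 * (Fintype.card (BenalohLeichter.Rand (I.φ j)) * ∑ t : Fin I.Δ, Fintype.card (NWExtract.Adv I.E (k, t))))
      ≤ ∑ _j : Fin I.ν, 2 ^ (1 + I.logLam + (I.logLam + 2 ^ (I.logLam - 6))) := Finset.sum_le_sum fun j _ => hinner j
    _ = I.ν * 2 ^ (1 + I.logLam + (I.logLam + 2 ^ (I.logLam - 6))) := by simp
    _ ≤ 2 ^ (I.logLam / 4) * 2 ^ (1 + I.logLam + (I.logLam + 2 ^ (I.logLam - 6))) := Nat.mul_le_mul_right _ hB.ν_le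
    _ = 2 ^ (I.logLam / 4 + (1 + I.logLam + (I.logLam + 2 ^ (I.logLam - 6)))) := by rw [← pow_add]
    _ ≤ 2 ^ (3 * I.logLam + 2 ^ (I.logLam - 6)) := Nat.pow_le_pow_right (by norm_num) (by omega)

end Cards

/-! ### The density inequality -/

section Density

variable (hB : I.Big)
include hB

omit hB in
/-- `3^{12 q} ≥ 2^{19 q}`. [folklore] -/
theorem two_pow_19_le_three_pow_12 (q : ℕ) : 2 ^ (19 * q) ≤ 3 ^ (12 * q) := by
  rw [pow_mul, pow_mul]
  exact Nat.pow_le_pow_left (by norm_num) q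

/-- The exponent of the "stuff" is at most `2^{N-3}`. [cite: Hirahara2022PartialMCSP, proof of Lemma 8.3 (K^D(f_k) ≤ o(λ w(k)))] -/
theorem Big.stuff_exp_le (k : Fin I.n) :
    (3 * I.logLam + 2 ^ (I.logLam - 6)) + 38 * I.logLam + I.logLam +
      (2 * I.logLam + 18 * I.N k + 1 + 24 * I.logLam * 2 ^ (I.N k / 2)) * (2 ^ 17 * I.logLam ^ 4) ≤
      2 ^ (I.N k - 3) := by
  have hΛ := hB.Λ_ge
  have hN := I.logLam_lt_N k
  have hΛ16 := hB.Λ_le_two_pow_div16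
  set N := I.N k with hNdef
  -- small terms
  have h1 : 2 ^ (I.logLam - 6) ≤ 2 ^ (N - 7) := Nat.pow_le_pow_right (by norm_num) (by omega)
  have h2 : 3 * I.logLam + 38 * I.logLam + I.logLam ≤ 2 ^ (N - 7) := by
    calc 3 * I.logLam + 38 * I.logLam + I.logLam = 42 * I.logLam := by ring
      _ ≤ 2 ^ 6 * 2 ^ (I.logLam / 16) := by
          calc 42 * I.logLam ≤ 64 * I.logLam := by omega
            _ = 2 ^ 6 * I.logLam := by norm_num
            _ ≤ 2 ^ 6 * 2 ^ (I.logLam / 16) := Nat.mul_le_mul_left _ hΛ16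
      _ = 2 ^ (6 + I.logLam / 16) := by rw [← pow_add]
      _ ≤ 2 ^ (N - 7) := Nat.pow_le_pow_right (by norm_num) (by omega)
  -- the big term: `(45 N 2^{N/2}) (2^17 N^4) ≤ 2^{N-4}`
  set x := N / 2 with hx
  have hx128 : 128 ≤ x := by omega
  have hNx : N ≤ 3 * x := by omega
  have h3 : (2 * I.logLam + 18 * N + 1 + 24 * I.logLam * 2 ^ x) * (2 ^ 17 * I.logLam ^ 4) ≤ 2 ^ (N - 4) := by
    have hΛN : I.logLam ≤ N := hN.le
    have he : 2 * I.logLam + 18 * N + 1 + 24 * I.logLam * 2 ^ x ≤ 45 * N * 2 ^ x := by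
      have h21 : 2 * I.logLam + 18 * N + 1 ≤ 21 * N := by omega
      have hp : 1 ≤ 2 ^ x := Nat.one_le_two_pow
      calc 2 * I.logLam + 18 * N + 1 + 24 * I.logLam * 2 ^ x ≤ 21 * N * 2 ^ x + 24 * N * 2 ^ x := by
            apply Nat.add_le_add
            · calc 2 * I.logLam + 18 * N + 1 ≤ 21 * N := h21
                _ = 21 * N * 1 := (mul_one _).symm
                _ ≤ 21 * N * 2 ^ x := Nat.mul_le_mul_left _ hp
            · exact Nat.mul_le_mul_right _ (Nat.mul_le_mul_left _ hΛN)
        _ = 45 * N * 2 ^ x := by ring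
    have hC : 2 ^ 17 * I.logLam ^ 4 ≤ 2 ^ 17 * N ^ 4 := Nat.mul_le_mul_left _ (Nat.pow_le_pow_left hΛN 4)
    have hpoly : 45 * N * (2 ^ 17 * N ^ 4) ≤ 2 ^ (x - 4) := by
      calc 45 * N * (2 ^ 17 * N ^ 4) = 45 * 2 ^ 17 * N ^ 5 := by ring
        _ ≤ 45 * 2 ^ 17 * (3 * x) ^ 5 := by gcongr
        _ = 45 * 3 ^ 5 * 2 ^ 17 * x ^ 5 := by ring
        _ ≤ 2 ^ 14 * 2 ^ 17 * x ^ 5 := by gcongr; norm_num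
        _ = 2 ^ 31 * x ^ 5 := by rw [← pow_add]
        _ ≤ 2 ^ (x - 4) := by
            have h := two_pow_mul_pow_le (a := 35) (k := 5) hx128 (by omega)
            have : 2 ^ 31 * x ^ 5 * 2 ^ 4 ≤ 2 ^ (x - 4) * 2 ^ 4 := by
              calc 2 ^ 31 * x ^ 5 * 2 ^ 4 = 2 ^ 35 * x ^ 5 := by ring
                _ ≤ 2 ^ x := h
                _ = 2 ^ (x - 4) * 2 ^ 4 := by rw [← pow_add, Nat.sub_add_cancel (by omega)]
            exact Nat.le_of_mul_le_mul_right this (by norm_num)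
    calc (2 * I.logLam + 18 * N + 1 + 24 * I.logLam * 2 ^ x) * (2 ^ 17 * I.logLam ^ 4)
        ≤ (45 * N * 2 ^ x) * (2 ^ 17 * N ^ 4) := Nat.mul_le_mul he hC
      _ = 45 * N * (2 ^ 17 * N ^ 4) * 2 ^ x := by ring
      _ ≤ 2 ^ (x - 4) * 2 ^ x := Nat.mul_le_mul_right _ hpoly
      _ = 2 ^ (x - 4 + x) := by rw [← pow_add]
      _ ≤ 2 ^ (N - 4) := Nat.pow_le_pow_right (by norm_num) (by omega)
  -- sum up: `2^{N-7} + 2^{N-7} + 2^{N-4} ≤ 2^{N-3}`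
  have hsum : 2 ^ (N - 7) + 2 ^ (N - 7) + 2 ^ (N - 4) ≤ 2 ^ (N - 3) := by
    have e1 : 2 ^ (N - 3) = 2 ^ (N - 7) * 16 := by
      rw [show (16 : ℕ) = 2 ^ 4 by norm_num, ← pow_add]; congr 1; omega
    have e2 : 2 ^ (N - 4) = 2 ^ (N - 7) * 8 := by
      rw [show (8 : ℕ) = 2 ^ 3 by norm_num, ← pow_add]; congr 1; omega
    rw [e1, e2]; omega
  calc (3 * I.logLam + 2 ^ (I.logLam - 6)) + 38 * I.logLam + I.logLam +
        (2 * I.logLam + 18 * N + 1 + 24 * I.logLam * 2 ^ x) * (2 ^ 17 * I.logLam ^ 4)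
      = 2 ^ (I.logLam - 6) + (3 * I.logLam + 38 * I.logLam + I.logLam) +
          (2 * I.logLam + 18 * N + 1 + 24 * I.logLam * 2 ^ x) * (2 ^ 17 * I.logLam ^ 4) := by ring
    _ ≤ 2 ^ (N - 7) + 2 ^ (N - 7) + 2 ^ (N - 4) := Nat.add_le_add (Nat.add_le_add h1 h2) h3
    _ ≤ 2 ^ (N - 3) := hsum

/-- **The density inequality** of `card_output_mem_mul_three_le`. [cite: Hirahara2022PartialMCSP, Lemma 8.1 and proof of Lemma 8.3 ((1 − o(1)) λ w(k) ≤ …)] -/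
theorem Big.hdens (k : Fin I.n) :
    2 ^ (2 ^ I.N k / 16) * (Fintype.card (Par I.E I.φ k) * Fintype.card (I.A.Suf k) *
        (I.Ccap ^ 2 + 1) * Fintype.card (IWAmp.Adv (I.A.eA k) (m := I.A.mI k)) ^ (I.Ccap ^ 2)) * 4 ^ (2 ^ I.N k) ≤
      2 ^ (2 ^ I.N k) * 3 ^ (2 ^ I.N k - 2 ^ I.N k / 4) := by
  have hN4 : 4 ≤ I.N k := by have := I.logLam_lt_N k; have := hB.Λ_ge; omega
  set q := 2 ^ (I.N k - 4) with hq
  have hM : 2 ^ I.N k = 16 * q := by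
    rw [hq, show (16 : ℕ) = 2 ^ 4 by norm_num, ← pow_add]; congr 1; omega
  -- the stuff is at most `2^{2q}`
  have hstuff : Fintype.card (Par I.E I.φ k) * Fintype.card (I.A.Suf k) * (I.Ccap ^ 2 + 1) *
      Fintype.card (IWAmp.Adv (I.A.eA k) (m := I.A.mI k)) ^ (I.Ccap ^ 2) ≤ 2 ^ (2 * q) := by
    have hA : Fintype.card (IWAmp.Adv (I.A.eA k) (m := I.A.mI k)) ^ (I.Ccap ^ 2) ≤
        2 ^ ((2 * I.logLam + 18 * I.N k + 1 + 24 * I.logLam * 2 ^ (I.N k / 2)) * (2 ^ 17 * I.logLam ^ 4)) := by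
      calc Fintype.card (IWAmp.Adv (I.A.eA k) (m := I.A.mI k)) ^ (I.Ccap ^ 2)
          ≤ (2 ^ (2 * I.logLam + 18 * I.N k + 1 + 24 * I.logLam * 2 ^ (I.N k / 2))) ^ (I.Ccap ^ 2) :=
            Nat.pow_le_pow_left (hB.card_AdvIW_le k) _
        _ = 2 ^ ((2 * I.logLam + 18 * I.N k + 1 + 24 * I.logLam * 2 ^ (I.N k / 2)) * I.Ccap ^ 2) := by rw [← pow_mul]
        _ ≤ _ := Nat.pow_le_pow_right (by norm_num) (Nat.mul_le_mul_left _ hB.Ccap_sq_le)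
    have h := mul_le_two_pow_add (mul_le_two_pow_add (mul_le_two_pow_add (hB.card_Par_le k) (hB.card_Suf_le k))
      hB.Ccap_sq_succ_le_two_pow) hA
    refine h.trans (Nat.pow_le_pow_right (by norm_num) ?_)
    have := hB.stuff_exp_le k
    have e : 2 ^ (I.N k - 3) = 2 * q := by
      rw [hq, ← pow_succ']; congr 1; omega
    omega
  -- assemble: `2^q · 2^{2q} · 2^{32q} ≤ 2^{16q} · 3^{12q}`
  rw [hM, Nat.mul_div_cancel_left q (by norm_num : 0 < 16)]
  have h4 : 4 ^ (16 * q) = 2 ^ (32 * q) := by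
    rw [show (4 : ℕ) = 2 ^ 2 by norm_num, ← pow_mul]; congr 1; ring
  have hsub : 16 * q - 16 * q / 4 = 12 * q := by
    rw [show 16 * q / 4 = 4 * q by omega]; omega
  rw [h4, hsub]
  calc 2 ^ q * (Fintype.card (Par I.E I.φ k) * Fintype.card (I.A.Suf k) * (I.Ccap ^ 2 + 1) *
        Fintype.card (IWAmp.Adv (I.A.eA k) (m := I.A.mI k)) ^ (I.Ccap ^ 2)) * 2 ^ (32 * q)
      ≤ 2 ^ q * 2 ^ (2 * q) * 2 ^ (32 * q) :=
        Nat.mul_le_mul_right _ (Nat.mul_le_mul_left _ hstuff)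
    _ = 2 ^ (16 * q) * 2 ^ (19 * q) := by rw [← pow_add, ← pow_add, ← pow_add]; congr 1; ring
    _ ≤ 2 ^ (16 * q) * 3 ^ (12 * q) := Nat.mul_le_mul_left _ (two_pow_19_le_three_pow_12 q)

end Density

/-! ### The final union-bound inequality -/

section Final

variable (hB : I.Big)
include hB

/-- `Λ^4 ≤ 2^{Λ/4}`. [folklore] -/
theorem Big.Λ_pow_four_le : I.logLam ^ 4 ≤ 2 ^ (I.logLam / 4) :=
  (pow_le_two_pow_mul_div16 (le_trans (by norm_num) hB.Λ_ge) 4).trans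
    (Nat.pow_le_pow_right (by norm_num) (by have := hB.Λ_ge; omega))

/-- The non-dominant part of `s_P` is at most `2^{Λ/2 + 9}`. [cite: Hirahara2022PartialMCSP, proof of Lemma 8.3 (completeness: "+ (nm)² + O(mΔ)" overheads are o(s/log s))] -/
theorem Big.sP_rest_le :
    I.n * (I.Δ * I.kA * (I.Nbig * (2 * I.mI + 3)) + I.Δ * (I.kA + 1)) +
      (Lupanov.mintermBound I.Lj + I.ν * (2 * I.Δ + 1) + (2 * I.ν + 1)) ≤ 2 ^ (I.logLam / 2 + 9) := by
  have hΛ := hB.Λ_ge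
  have hΔ : I.Δ ≤ I.logLam := hB.Δ_le.trans (Nat.div_le_self _ _)
  have hkA := hB.kA_le
  have hNbig : I.Nbig ≤ 3 * I.logLam := by have := hB.Nbig_le; omega
  have hmI : 2 * I.mI + 3 ≤ 3 * I.logLam := by have := hB.mI_le; omega
  have hΛ16 := hB.Λ_le_two_pow_div16
  -- the per-variable polylog part
  have hinner : I.Δ * I.kA * (I.Nbig * (2 * I.mI + 3)) + I.Δ * (I.kA + 1) ≤ 2 ^ 8 * I.logLam ^ 4 := by
    calc I.Δ * I.kA * (I.Nbig * (2 * I.mI + 3)) + I.Δ * (I.kA + 1)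
        ≤ I.logLam * (24 * I.logLam) * (3 * I.logLam * (3 * I.logLam)) + I.logLam * (24 * I.logLam + 1) := by
          gcongr
      _ ≤ 2 ^ 8 * I.logLam ^ 4 := by
          have : 1 ≤ I.logLam := by omega
          nlinarith [Nat.one_le_pow 2 I.logLam this, Nat.one_le_pow 3 I.logLam this]
  have h1 : I.n * (I.Δ * I.kA * (I.Nbig * (2 * I.mI + 3)) + I.Δ * (I.kA + 1)) ≤ 2 ^ (I.logLam / 2 + 8) := by
    calc I.n * (I.Δ * I.kA * (I.Nbig * (2 * I.mI + 3)) + I.Δ * (I.kA + 1)) ≤ 2 ^ (I.logLam / 4) * (2 ^ 8 * I.logLam ^ 4) :=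
          Nat.mul_le_mul hB.n_le hinner
      _ ≤ 2 ^ (I.logLam / 4) * (2 ^ 8 * 2 ^ (I.logLam / 4)) := Nat.mul_le_mul_left _ (Nat.mul_le_mul_left _ hB.Λ_pow_four_le)
      _ = 2 ^ (I.logLam / 4 + (8 + I.logLam / 4)) := by rw [← pow_add, ← pow_add]
      _ ≤ 2 ^ (I.logLam / 2 + 8) := Nat.pow_le_pow_right (by norm_num) (by omega)
  -- the selector and reconstruction part
  have hpowlog : 2 ^ Nat.log 2 I.ν ≤ 2 ^ (I.logLam / 4) := by
    rcases Nat.eq_zero_or_pos I.ν with h0 | hpos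
    · rw [h0, Nat.log_zero_right, pow_zero]; exact Nat.one_le_two_pow
    · exact (Nat.pow_log_le_self 2 hpos.ne').trans hB.ν_le
  have h2 : Lupanov.mintermBound I.Lj + I.ν * (2 * I.Δ + 1) + (2 * I.ν + 1) ≤ 2 ^ (I.logLam / 2) := by
    have hm : Lupanov.mintermBound I.Lj ≤ 4 * 2 ^ (I.logLam / 4) := by
      calc Lupanov.mintermBound I.Lj ≤ 2 ^ (I.Lj + 1) := Lupanov.mintermBound_le _
        _ = 4 * 2 ^ Nat.log 2 I.ν := by unfold Lj; rw [pow_add, pow_succ]; ring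
        _ ≤ 4 * 2 ^ (I.logLam / 4) := Nat.mul_le_mul_left _ hpowlog
    have hν := hB.ν_le
    have hmid : I.ν * (2 * I.Δ + 1) ≤ 2 ^ (I.logLam / 4) * (2 ^ 2 * 2 ^ (I.logLam / 16)) := by
      refine Nat.mul_le_mul hν ?_
      calc 2 * I.Δ + 1 ≤ 3 * I.logLam := by omega
        _ ≤ 2 ^ 2 * I.logLam := by omega
        _ ≤ 2 ^ 2 * 2 ^ (I.logLam / 16) := Nat.mul_le_mul_left _ hΛ16
    have e1 : 2 ^ (I.logLam / 4) * (2 ^ 2 * 2 ^ (I.logLam / 16)) = 2 ^ (I.logLam / 4 + (2 + I.logLam / 16)) := by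
      rw [← pow_add, ← pow_add]
    rw [e1] at hmid
    have hA : 2 ^ (I.logLam / 4 + (2 + I.logLam / 16)) ≤ 2 ^ (I.logLam / 2 - 2) := Nat.pow_le_pow_right (by norm_num) (by omega)
    have hB' : 2 ^ (I.logLam / 4) ≤ 2 ^ (I.logLam / 2 - 5) := Nat.pow_le_pow_right (by norm_num) (by omega)
    have e2 : 2 ^ (I.logLam / 2) = 2 ^ (I.logLam / 2 - 5) * 32 := by
      rw [show (32 : ℕ) = 2 ^ 5 by norm_num, ← pow_add]; congr 1; omega
    have e3 : 2 ^ (I.logLam / 2 - 2) = 2 ^ (I.logLam / 2 - 5) * 8 := by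
      rw [show (8 : ℕ) = 2 ^ 3 by norm_num, ← pow_add]; congr 1; omega
    rw [e3] at hA
    rw [e2]
    have : 1 ≤ 2 ^ (I.logLam / 2 - 5) := Nat.one_le_two_pow
    omega
  have e : 2 ^ (I.logLam / 2 + 9) = 2 ^ (I.logLam / 2 + 8) + 2 ^ (I.logLam / 2 + 8) := by rw [pow_succ]; ring
  rw [e]
  exact Nat.add_le_add h1 (h2.trans (Nat.pow_le_pow_right (by norm_num) (by omega)))

/-- `s_P ≤ 2^{2Λ+9} + 2^{Λ/2+9}`. [folklore] -/
theorem Big.sP_le : I.sP ≤ 2 ^ (2 * I.logLam + 9) + 2 ^ (I.logLam / 2 + 9) := by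
  unfold sP
  rw [add_assoc]
  refine Nat.add_le_add ?_ hB.sP_rest_le
  calc 320 * I.lam * I.θ / I.logLam ≤ 320 * I.lam * I.θ := Nat.div_le_self _ _
    _ ≤ 2 ^ 9 * 2 ^ I.logLam * 2 ^ I.logLam := by
        unfold lam; exact Nat.mul_le_mul (Nat.mul_le_mul_right _ (by norm_num)) hB.θ_le
    _ = 2 ^ (2 * I.logLam + 9) := by rw [← pow_add, ← pow_add]; congr 1; ring

/-- `Lx ≤ 2^{Λ-7}`. [folklore] -/
theorem Big.Lx_le : Lx I.Lj I.dNW I.Δ I.Δ ≤ 2 ^ (I.logLam - 7) := by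
  have hΛ := hB.Λ_ge
  have hd : I.dNW ≤ 2 ^ (I.logLam - 8) := by
    unfold dNW
    calc I.ℓ * 4 ^ 140 ≤ 38 * I.logLam * 2 ^ 280 := by
          rw [show (4 : ℕ) ^ 140 = 2 ^ 280 by rw [show (4 : ℕ) = 2 ^ 2 by norm_num, ← pow_mul]]
          exact Nat.mul_le_mul_right _ hB.ℓ_le
      _ ≤ 2 ^ 6 * 2 ^ (I.logLam / 16) * 2 ^ 280 :=
          Nat.mul_le_mul_right _ (Nat.mul_le_mul (by norm_num) hB.Λ_le_two_pow_div16)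
      _ = 2 ^ (6 + I.logLam / 16 + 280) := by rw [← pow_add, ← pow_add]
      _ ≤ 2 ^ (I.logLam - 8) := Nat.pow_le_pow_right (by norm_num) (by omega)
  have hLj : I.Lj ≤ I.logLam / 4 + 1 := by
    unfold Lj
    have : Nat.log 2 I.ν ≤ I.logLam / 4 := by
      calc Nat.log 2 I.ν ≤ Nat.log 2 (2 ^ (I.logLam / 4)) := Nat.log_mono_right hB.ν_le
        _ = I.logLam / 4 := Nat.log_pow (by norm_num) _
    omega
  have hΔΔ : I.Δ * I.Δ ≤ I.logLam / 4 := hB.Δsq_le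
  have hsmall : I.logLam / 4 + 1 + I.logLam / 4 ≤ 2 ^ (I.logLam - 8) := by
    calc I.logLam / 4 + 1 + I.logLam / 4 ≤ I.logLam := by omega
      _ ≤ 2 ^ (I.logLam / 16) := hB.Λ_le_two_pow_div16
      _ ≤ 2 ^ (I.logLam - 8) := Nat.pow_le_pow_right (by norm_num) (by omega)
  have e : 2 ^ (I.logLam - 7) = 2 ^ (I.logLam - 8) + 2 ^ (I.logLam - 8) := by
    rw [← two_mul, ← pow_succ']; congr 1; omega
  unfold Lx
  rw [e]
  omega

/-- `Lx + s_P + 2 ≤ 2^{2Λ+10}`. [folklore] -/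
theorem Big.base_le : Lx I.Lj I.dNW I.Δ I.Δ + I.sP + 2 ≤ 2 ^ (2 * I.logLam + 10) := by
  have hΛ := hB.Λ_ge
  have h1 := hB.Lx_le
  have h2 := hB.sP_le
  have ha : 2 ^ (I.logLam - 7) ≤ 2 ^ (2 * I.logLam + 6) := Nat.pow_le_pow_right (by norm_num) (by omega)
  have hb : 2 ^ (I.logLam / 2 + 9) ≤ 2 ^ (2 * I.logLam + 6) := Nat.pow_le_pow_right (by norm_num) (by omega)
  have hc : (2 : ℕ) ≤ 2 ^ (2 * I.logLam + 6) := by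
    calc (2 : ℕ) = 2 ^ 1 := by norm_num
      _ ≤ 2 ^ (2 * I.logLam + 6) := Nat.pow_le_pow_right (by norm_num) (by omega)
  have e1 : 2 ^ (2 * I.logLam + 9) = 2 ^ (2 * I.logLam + 6) * 8 := by
    rw [show (8 : ℕ) = 2 ^ 3 by norm_num, ← pow_add]
  have e2 : 2 ^ (2 * I.logLam + 10) = 2 ^ (2 * I.logLam + 6) * 16 := by
    rw [show (16 : ℕ) = 2 ^ 4 by norm_num, ← pow_add]
  rw [e2]; rw [e1] at h2; omega

/-- `(2Λ + 10) · (320 λ θ / Λ) ≤ 960 λ θ`. [folklore] -/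
theorem Big.main_term_le : (2 * I.logLam + 10) * (320 * I.lam * I.θ / I.logLam) ≤ 960 * I.lam * I.θ := by
  have hΛ := hB.Λ_ge
  calc (2 * I.logLam + 10) * (320 * I.lam * I.θ / I.logLam) ≤ 3 * I.logLam * (320 * I.lam * I.θ / I.logLam) :=
        Nat.mul_le_mul_right _ (by omega)
    _ = 3 * (I.logLam * (320 * I.lam * I.θ / I.logLam)) := by ring
    _ ≤ 3 * (320 * I.lam * I.θ) := Nat.mul_le_mul_left _ (Nat.mul_div_le _ _)
    _ = 960 * I.lam * I.θ := by ring

/-- **The final inequality** of `card_output_mem_mul_three_le`, for `W₀ ≥ 107520 θ`.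
[cite: Hirahara2022PartialMCSP, proof of Lemma 8.3 (soundness: "|M| ≤ O(s log s) … (1 − o(1)) λ w(B) ≤ |M| … w(B) < θ" with the gap g) and proof of Thm. 8.5] -/
theorem Big.hfinal (W₀ : ℕ) (hW : 107520 * I.θ ≤ W₀) :
    (tests I.Lj I.ν I.dNW I.Δ I.Δ I.sP).card * 2 ^ I.n * 3 ≤ 2 ^ (2 ^ (I.logLam - 4) * (W₀ + 1)) := by
  have hΛ := hB.Λ_ge
  have hΛ16 := hB.Λ_le_two_pow_div16
  -- the number of tests
  have hT : (tests I.Lj I.ν I.dNW I.Δ I.Δ I.sP).card ≤ 2 ^ ((2 * I.logLam + 10) * (7 * I.sP + 2)) := by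
    calc (tests I.Lj I.ν I.dNW I.Δ I.Δ I.sP).card ≤ (Lx I.Lj I.dNW I.Δ I.Δ + I.sP + 2) ^ (7 * I.sP + 2) := card_tests_le _ _ _ _ _ _
      _ ≤ (2 ^ (2 * I.logLam + 10)) ^ (7 * I.sP + 2) := Nat.pow_le_pow_left hB.base_le _
      _ = 2 ^ ((2 * I.logLam + 10) * (7 * I.sP + 2)) := by rw [← pow_mul]
  -- the exponent
  have hexp : (2 * I.logLam + 10) * (7 * I.sP + 2) + I.n + 2 ≤ 2 ^ (I.logLam - 4) * (W₀ + 1) := by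
    -- split `s_P`
    have hsP : I.sP = 320 * I.lam * I.θ / I.logLam + (I.n * (I.Δ * I.kA * (I.Nbig * (2 * I.mI + 3)) + I.Δ * (I.kA + 1)) +
        (Lupanov.mintermBound I.Lj + I.ν * (2 * I.Δ + 1) + (2 * I.ν + 1))) := by unfold sP; ring
    set X := I.n * (I.Δ * I.kA * (I.Nbig * (2 * I.mI + 3)) + I.Δ * (I.kA + 1)) +
        (Lupanov.mintermBound I.Lj + I.ν * (2 * I.Δ + 1) + (2 * I.ν + 1)) with hX
    have hXle : X ≤ 2 ^ (I.logLam / 2 + 9) := hB.sP_rest_le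
    have hmain := hB.main_term_le
    -- main part: `7 (2Λ+10) main ≤ 6720 λ θ = 107520 · 2^{Λ-4} θ`
    have hlam : I.lam = 2 ^ (I.logLam - 4) * 16 := by
      unfold lam; rw [show (16 : ℕ) = 2 ^ 4 by norm_num, ← pow_add, Nat.sub_add_cancel (by omega)]
    have hrest : 7 * ((2 * I.logLam + 10) * X) + 2 * (2 * I.logLam + 10) + I.n + 2 ≤ 2 ^ (I.logLam - 4) := by
      have hx1 : (2 * I.logLam + 10) * X ≤ 2 ^ (I.logLam - 9) := by
        calc (2 * I.logLam + 10) * X ≤ (2 ^ 2 * I.logLam) * 2 ^ (I.logLam / 2 + 9) := Nat.mul_le_mul (by omega) hXle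
          _ ≤ (2 ^ 2 * 2 ^ (I.logLam / 16)) * 2 ^ (I.logLam / 2 + 9) := Nat.mul_le_mul_right _ (Nat.mul_le_mul_left _ hΛ16)
          _ = 2 ^ (2 + I.logLam / 16 + (I.logLam / 2 + 9)) := by rw [← pow_add, ← pow_add]
          _ ≤ 2 ^ (I.logLam - 9) := Nat.pow_le_pow_right (by norm_num) (by omega)
      have hx2 : 2 * (2 * I.logLam + 10) + I.n + 2 ≤ 2 ^ (I.logLam - 9) := by
        calc 2 * (2 * I.logLam + 10) + I.n + 2 ≤ 8 * I.logLam + 2 ^ (I.logLam / 4) := by have := hB.n_le; omega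
          _ ≤ 2 ^ 3 * 2 ^ (I.logLam / 16) + 2 ^ (I.logLam / 4) := by omega
          _ = 2 ^ (3 + I.logLam / 16) + 2 ^ (I.logLam / 4) := by rw [← pow_add]
          _ ≤ 2 ^ (I.logLam - 10) + 2 ^ (I.logLam - 10) :=
              Nat.add_le_add (Nat.pow_le_pow_right (by norm_num) (by omega)) (Nat.pow_le_pow_right (by norm_num) (by omega))
          _ = 2 ^ (I.logLam - 9) := by rw [← two_mul, ← pow_succ']; congr 1; omega
      have e : 2 ^ (I.logLam - 4) = 2 ^ (I.logLam - 9) * 32 := by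
        rw [show (32 : ℕ) = 2 ^ 5 by norm_num, ← pow_add]; congr 1; omega
      rw [e]; omega
    calc (2 * I.logLam + 10) * (7 * I.sP + 2) + I.n + 2
        = 7 * ((2 * I.logLam + 10) * (320 * I.lam * I.θ / I.logLam)) +
            (7 * ((2 * I.logLam + 10) * X) + 2 * (2 * I.logLam + 10) + I.n + 2) := by rw [hsP]; ring
      _ ≤ 7 * (960 * I.lam * I.θ) + 2 ^ (I.logLam - 4) := Nat.add_le_add (Nat.mul_le_mul_left _ hmain) hrest
      _ = 2 ^ (I.logLam - 4) * (107520 * I.θ) + 2 ^ (I.logLam - 4) := by rw [hlam]; ring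
      _ ≤ 2 ^ (I.logLam - 4) * W₀ + 2 ^ (I.logLam - 4) := Nat.add_le_add_right (Nat.mul_le_mul_left _ hW) _
      _ = 2 ^ (I.logLam - 4) * (W₀ + 1) := by ring
  calc (tests I.Lj I.ν I.dNW I.Δ I.Δ I.sP).card * 2 ^ I.n * 3
      ≤ 2 ^ ((2 * I.logLam + 10) * (7 * I.sP + 2)) * 2 ^ I.n * 2 ^ 2 :=
        Nat.mul_le_mul (Nat.mul_le_mul_right _ hT) (by norm_num)
    _ = 2 ^ ((2 * I.logLam + 10) * (7 * I.sP + 2) + I.n + 2) := by rw [← pow_add, ← pow_add]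
    _ ≤ 2 ^ (2 ^ (I.logLam - 4) * (W₀ + 1)) := Nat.pow_le_pow_right (by norm_num) hexp

end Final

/-! ### The two guarantees under the largeness hypotheses -/

section Wrap

variable (hB : I.Big)
include hB

/-- **Completeness, unconditional form**: under `Big`, a positive-weight witness of weight `≤ θ`
accepted by every formula puts the output in `MCSP*` for every coin outcome.
[cite: Hirahara2022PartialMCSP, proof of Lemma 8.3 (completeness) and of Thm. 8.5 (MCSP* case)] -/
theorem Big.output_mem_of_witness (T : Finset (Fin I.n)) (hTw : ∀ k ∈ T, 1 ≤ I.w k)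
    (hTθ : ∑ k ∈ T, I.w k ≤ I.θ) (hauth : ∀ j, T.image Fin.val ∈ (I.φ j).accessStructure.authorized)
    (F : Coins I.A) : I.output F ∈ MCSPStar :=
  I.output_mem_of_witness hB.good hB.hmass T hTw hTθ hauth F

/-- **Soundness, unconditional form**: under `Big` and `W₀ ≥ 107520 θ`, if every set of variables
accepted by all formulas has weight `> W₀`, then at most a third of the coin outcomes put the output
in `MCSP*`. [cite: Hirahara2022PartialMCSP, proof of Lemma 8.3 (soundness) and of Thm. 8.5 (MCSP* case)] -/
theorem Big.card_output_mem_mul_three_le (W₀ : ℕ) (hW : 107520 * I.θ ≤ W₀)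
    (hNo : ∀ S : Finset (Fin I.n), (∀ j, S.image Fin.val ∈ (I.φ j).accessStructure.authorized) → W₀ < ∑ k ∈ S, I.w k) :
    ((univ : Finset (Coins I.A)).filter fun F => I.output F ∈ MCSPStar).card * 3 ≤ Fintype.card (Coins I.A) :=
  I.card_output_mem_mul_three_le hB.good W₀ hNo (fun k _ => hB.hdens k) (hB.hfinal W₀ hW)

end Wrap

end PInst

end HiraharaRed

end Literature.Computability.Complexity
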